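import Summits.BirchSwinnertonDyer.BirchSwinnertonDyer.Theorems.ByReductionTypeAtTwoOrdKatoHalfAtTwoIsoColemanHalfClassDefs
import Summits.BirchSwinnertonDyer.BirchSwinnertonDyer.Theorems.ByReductionTypeAtTwoOrdKatoHalfAtTwoIsoPosDiscEpsilon
import HarnessLib

/-!
# Route ByReductionTypeAtTwo, crux `OrdKatoHalfAtTwoIso` (stmt-BirchSwinnertonDyer-19573): the crux's THREE Coleman inputs in
# ONE per-datum currency — `HasColemanHalfClassPackageAtTwo` on the cells [`ρ̄₂` onto ∧ `0 < Δ`] (lead g6's P⁺) and [`ρ̄₂` not onto]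
# (child B7′), the zeta reading F1μι⁻ on [`ρ̄₂` onto ∧ `Δ < 0`] — and the crux BY NAME from them + Iw⁺ + print (theorems only)

Seat `cruxlead-stmt-BirchSwinnertonDyer-19573-w2` GEN 4 (prover WIDTH under the LEAD `cruxlead-19573` g6; HOME
`run/shared/lean/pub/bsd-2adic/`; `--supports` stmt-BirchSwinnertonDyer-23921; pen RC-397 (2) / RC-400 (ii)). HONEST FRAMING (cell
bsd-2adic): BSD is not proved by any of this; the crux, its PAIR child 24097, B7′ (23921) and the `0 < Δ` conjunct are NOT proved here;
THEOREMS ONLY, every one CONDITIONAL on the displayed OPEN statements it names (memo-tier readings `ZetaColemanMuIotaNegDiscAtTwo`,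
`HasColemanHalfClassPackageAtTwo`, lead g6's P⁺/Q⁺/Iw⁺) and on PRINT facts by name. An OFFER to the lead's (ε) line (one-writer rule
respected: no text of the lead is touched; new names only).

WHAT. Lead g6's P⁺ `ColemanMuSpanFreeIotaPosDiscAtTwo` (p699544) is VERBATIM the `∀`-form on the cell [`ρ̄₂` onto ∧ `0 < Δ`] of the
typed per-datum package `HasColemanHalfClassPackageAtTwo` (p700838) at `θ = ι`; B7′ (child 23921) is that package at the lattice-optimal
member on [`ρ̄₂` not onto] plus print (p700838 `katoMuPartOff514_of_print_of_colemanHalfClassPackage`). So the crux's whole Coleman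
input reads in ONE currency:

* §1 `hasColemanHalfClassPackageAtTwo_of_colemanMuSpanFreeIotaPosDiscAtTwo` — P⁺ ⇒ the package on its cell (monotonicity);
  `halfClassPosDisc_of_colemanMuSpanFreeIotaPosDiscAtTwo` — the same as a `∀`-binder (Col½⁺ below).
* §2 the (ε) door in the typed currency: `katoMuPartAtTwo_of_halfClassPosDisc_of_conjA`,
  `mainConjectureLowerDivisibilityAtTwoOrd_of_halfClassPosDisc_of_conjA`, `ordKatoHalfAtTwoIsoPosDisc_of_halfClassPosDisc_of_conjA`
  — g6's `…_of_epsilon` chain with P⁺ replaced by (Col½⁺) «`HasColemanHalfClassPackageAtTwo W f κ γ D Y` for every curve of the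
  cell, every newform, all data» (weaker than P⁺: any `θ`, and the cell's `¬CM`/rank binders are available to the supplier).
* §3 **`ordKatoHalfAtTwoIso_of_negDisc_of_halfClass_of_conjA_of_print`** — THE CRUX BY NAME ⟸ F1μι⁻ (zeta reading, `Δ < 0`; its
  span clause feeds the PROVED core Theorem A there) + (Col½⁺) + Q⁺ + (Col½-opt) «the package at every lattice-optimal member of every
  non-CM good-ordinary not-onto class» + PRINT {bundle 23889 (PUB ∧ Abbes–Ullmo ∧ Greenberg 5.14@2), Lim 2017 Thm 3.5@2,
  Ferrero–Washington}; and `…_of_lim_of_classicalMu_…` with Q⁺ ⟸ Lim@2 + Iw⁺ (g6 `fineSelmerConjATwoOrdPosDisc_of_lim_of_classicalMu`).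
  B7′ is no longer a separate binder: it is the half-class reading at `W₀` + print (p699886/p700838).

What this is NOT: no reading is proved; nothing closed; no census number moves. The honest supplier road for both half-class
binders on `0 < Δ` (GENUINE classes in the relaxed-at-`∞` dual + the archimedean `Λ/2` + relaxed (A₂), MEMO-7 (1.1)(h) / [ASP] 6.9 (i))
is recorded on HOME (w2 GEN 4 INBOX 05:55Z), not built.

References: [Kato2004Asterisque] Thm 16.6, Prop 17.11, §17.13, Thm 17.4 (1)(2); [GreenbergLNM1716] §1 p. 60, Prop 5.14, Conj. 1.11;
[CoatesSujatha2005] Conj. A; [Lim2017FineSelmer] Thm 3.5; [FerreroWashington1979]; [Iwasawa1973MuInvariants]; [AbbesUllmo1996] Thm A;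
tree p693557, p695020, p699544 (`…PosDiscEpsilonDefs`), `…PosDiscEpsilon` (g6), p699886, p700838 (w2 GEN 4).
-/

set_option autoImplicit false
set_option linter.dupNamespace false

noncomputable section

open scoped Classical MatrixGroups ModularForm NumberField
open CongruenceSubgroup WeierstrassCurve Field IsDedekindDomain NumberField
open Literature.NumberTheory.GaloisRepresentations
open Literature.NumberTheory.GaloisCohomology
open Literature.NumberTheory.EllipticCurves Literature.NumberTheory.EllipticCurves.ModularForms
open Literature.NumberTheory.EllipticCurves.Kato2004
  Literature.NumberTheory.EllipticCurves.Kato2004.EulerSystemValues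
open Literature.NumberTheory.EllipticCurves.Rank1Residual
open Literature.NumberTheory.EllipticCurves.Greenberg1999
open Literature.NumberTheory.IwasawaTheory
open Summit.BirchSwinnertonDyer.BirchSwinnertonDyer.Theorems.Rank1ResidualX1Defs
  Summit.BirchSwinnertonDyer.BirchSwinnertonDyer.Rank1Residual
  Summit.BirchSwinnertonDyer.BirchSwinnertonDyer.Rank1Residual.CoreAssembly
open Summit.BirchSwinnertonDyer.Rank1Residual Summit.BirchSwinnertonDyer.Rank1Residual.X5
open Summit.BirchSwinnertonDyer.BirchSwinnertonDyer.Theorems.OrdKatoOptimalAtTwo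
  Summit.BirchSwinnertonDyer.BirchSwinnertonDyer.Theorems.OrdKatoIntAtTwo
open Summit.BirchSwinnertonDyer.BirchSwinnertonDyer.Theses.ByReductionTypeAtTwo

namespace Summit.BirchSwinnertonDyer.BirchSwinnertonDyer.Theorems.SteinbergFibreAtTwo

/-! ## §1 Lead g6's P⁺ is the typed half-class package on its cell -/

/-- **P⁺ `ColemanMuSpanFreeIotaPosDiscAtTwo` (lead g6, p699544) supplies `HasColemanHalfClassPackageAtTwo` at every curve of the cell
[ordinary at `2`, `ρ̄₂` onto, `0 < Δ`], every newform, all cyclotomic and dual data** (`θ = ι`; P⁺'s body is verbatim the package's).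
[folklore] -/
theorem hasColemanHalfClassPackageAtTwo_of_colemanMuSpanFreeIotaPosDiscAtTwo (hP : ColemanMuSpanFreeIotaPosDiscAtTwo)
    (W : WeierstrassCurve ℚ) [W.IsElliptic] [W.IsGloballyMinimal] (hord : IsOrdinaryAt W 2)
    (h2 : W.HasSurjectiveModNGaloisRep 2) (hΔ : 0 < W.Δ) {N : ℕ} [NeZero N] (f : CuspForm (Gamma0 N) 2)
    (hf : IsNewformOf W f) (κ : ZpExtension ℚ 2) (γ : absoluteGaloisGroup ℚ) (hκ : κ.IsCyclotomic)
    (hγ : κ.IsTopGenerator γ) (hγ' : IsCyclotomicVariable 2 γ) (D : W.SelmerDualData κ γ) (Y : W.FineSelmerDualData κ γ) :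
    HasColemanHalfClassPackageAtTwo W f κ γ D Y := by
  obtain ⟨P, M, τ, π, hτM, hπs, hπ, himg⟩ := hP W f κ γ hκ hord h2 hΔ hγ hγ' hf D Y
  exact hasColemanHalfClassPackageAtTwo_of_semilinear _ P M τ π hτM hπs hπ himg

/-- **(Col½⁺) from P⁺**: the typed binder «the half-class package at every curve of the cell [non-CM, analytic rank `0`, good ordinary
at `2`, `ρ̄₂` onto, `0 < Δ`]» is implied by P⁺ (which ignores the `¬CM` / rank binders and fixes `θ = ι`). [folklore] -/
theorem halfClassPosDisc_of_colemanMuSpanFreeIotaPosDiscAtTwo (hP : ColemanMuSpanFreeIotaPosDiscAtTwo) :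
    ∀ (W : WeierstrassCurve ℚ) [W.IsElliptic] [W.IsGloballyMinimal], ¬ W.HasCM → W.analyticRank = 0 →
      GoodOrd W 2 → W.HasSurjectiveModNGaloisRep 2 → 0 < W.Δ →
      ∀ {N : ℕ} [NeZero N] (f : CuspForm (Gamma0 N) 2) (κ : ZpExtension ℚ 2) (γ : absoluteGaloisGroup ℚ),
        κ.IsCyclotomic → κ.IsTopGenerator γ → IsCyclotomicVariable 2 γ → IsNewformOf W f →
        ∀ (D : W.SelmerDualData κ γ) (Y : W.FineSelmerDualData κ γ), HasColemanHalfClassPackageAtTwo W f κ γ D Y :=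
  fun W _ _ _ _ hgo h2 hΔ _ _ f κ γ hκ hγ hγ' hf D Y =>
    hasColemanHalfClassPackageAtTwo_of_colemanMuSpanFreeIotaPosDiscAtTwo hP W ⟨hgo.1, hgo.2⟩ h2 hΔ f hf κ γ hκ hγ hγ' D Y

/-! ## §2 The (ε) door in the typed per-datum currency -/

/-- **Kato's `μ`-part `X5.O1.KatoMuPartAtTwo W` at a curve of the cell [non-CM, analytic rank `0`, good ordinary at `2`, `ρ̄₂` onto,
`0 < Δ`], modulo (Col½⁺) and Q⁺ only** — p700838's one-curve door `katoMuPartAtTwo_of_hasColemanHalfClassPackageAtTwo_of_finite_fineSelmer_irr`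
(`E[2]` irreducible as `ρ̄₂` is onto) fed with (A) at `(W, 2)` from Q⁺ (g6 `finite_fineSelmerInfty_twoTorsion_of_conjA_two`). g6's
`katoMuPartAtTwo_of_epsilon` with P⁺ replaced by the typed binder. [cite: GreenbergLNM1716, Conj. 1.11 (p. 64) (shape)]
[cite: Kato2004Asterisque, §17.13 (pp. 279–280)] -/
theorem katoMuPartAtTwo_of_halfClassPosDisc_of_conjA
    (hPos : ∀ (W : WeierstrassCurve ℚ) [W.IsElliptic] [W.IsGloballyMinimal], ¬ W.HasCM → W.analyticRank = 0 →
      GoodOrd W 2 → W.HasSurjectiveModNGaloisRep 2 → 0 < W.Δ →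
      ∀ {N : ℕ} [NeZero N] (f : CuspForm (Gamma0 N) 2) (κ : ZpExtension ℚ 2) (γ : absoluteGaloisGroup ℚ),
        κ.IsCyclotomic → κ.IsTopGenerator γ → IsCyclotomicVariable 2 γ → IsNewformOf W f →
        ∀ (D : W.SelmerDualData κ γ) (Y : W.FineSelmerDualData κ γ), HasColemanHalfClassPackageAtTwo W f κ γ D Y)
    (hQ : FineSelmerConjATwoOrdPosDisc)
    (W : WeierstrassCurve ℚ) [W.IsElliptic] [W.IsGloballyMinimal] (hcm : ¬ W.HasCM) (hr : W.analyticRank = 0)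
    (hgo : GoodOrd W 2) (h2 : W.HasSurjectiveModNGaloisRep 2) (hΔ : 0 < W.Δ) : O1.KatoMuPartAtTwo W := by
  haveI : NeZero ((2 : ℕ) : ℚ) := ⟨by norm_num⟩
  exact katoMuPartAtTwo_of_hasColemanHalfClassPackageAtTwo_of_finite_fineSelmer_irr W
    (hasIrreducibleModPGaloisRep_of_hasSurjectiveModNGaloisRep W 2 h2)
    (fun f κ γ hκ hγ hγ' hf D Y ↦ hPos W hcm hr hgo h2 hΔ f κ γ hκ hγ hγ' hf D Y)
    (finite_fineSelmerInfty_twoTorsion_of_conjA_two W (hQ W hcm hr hgo h2 hΔ))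

/-- **Kato's integral lower divisibility `X5.O1.MainConjectureLowerDivisibilityAtTwoOrd W` AT a curve of the cell, modulo (Col½⁺), Q⁺,
Abbes–Ullmo BY NAME and Kato 17.4 (1)(2) at `W`** (`ord₂ ϖ = 0` on the good `E[2]`-irreducible locus, p654400). g6's
`mainConjectureLowerDivisibilityAtTwoOrd_of_epsilon` re-keyed. [cite: Kato2004Asterisque, Thm. 17.4 (1)(2) (p. 273)] [cite: AbbesUllmo1996, Thm. A] -/
theorem mainConjectureLowerDivisibilityAtTwoOrd_of_halfClassPosDisc_of_conjA
    (hPos : ∀ (W : WeierstrassCurve ℚ) [W.IsElliptic] [W.IsGloballyMinimal], ¬ W.HasCM → W.analyticRank = 0 →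
      GoodOrd W 2 → W.HasSurjectiveModNGaloisRep 2 → 0 < W.Δ →
      ∀ {N : ℕ} [NeZero N] (f : CuspForm (Gamma0 N) 2) (κ : ZpExtension ℚ 2) (γ : absoluteGaloisGroup ℚ),
        κ.IsCyclotomic → κ.IsTopGenerator γ → IsCyclotomicVariable 2 γ → IsNewformOf W f →
        ∀ (D : W.SelmerDualData κ γ) (Y : W.FineSelmerDualData κ γ), HasColemanHalfClassPackageAtTwo W f κ γ D Y)
    (hQ : FineSelmerConjATwoOrdPosDisc) (hAU : abbesUllmo_not_dvd_maninConstant_of_not_dvd_level)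
    (W : WeierstrassCurve ℚ) [W.IsElliptic] [W.IsGloballyMinimal] (hcm : ¬ W.HasCM) (hr : W.analyticRank = 0)
    (hgo : GoodOrd W 2) (h2 : W.HasSurjectiveModNGaloisRep 2) (hΔ : 0 < W.Δ)
    (h17 : ∀ [NeZero (W.conductorNorm ℤ)] (f : CuspForm (Gamma0 (W.conductorNorm ℤ)) 2),
      kato_divisibility_allPrimes W 2 (f := f)) :
    O1.MainConjectureLowerDivisibilityAtTwoOrd W := by
  haveI : NeZero ((2 : ℕ) : ℚ) := ⟨by norm_num⟩
  exact O1.mainConjectureLowerDivisibilityAtTwoOrd_of_katoMuPartAtTwo W h17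
    (fun f hf ϖ hϖ => hint_two_of_abbesUllmo_of_irr hAU W hgo
      (hasIrreducibleModPGaloisRep_of_hasSurjectiveModNGaloisRep W 2 h2) f hf ϖ hϖ)
    (katoMuPartAtTwo_of_halfClassPosDisc_of_conjA hPos hQ W hcm hr hgo h2 hΔ)

/-- **The `0 < Δ` conjunct `OrdKatoHalfAtTwoIsoPosDisc` BY NAME from (Col½⁺), Q⁺, Abbes–Ullmo and Kato 17.4 (1)(2) at `2`** (`W′ := W`).
g6's `ordKatoHalfAtTwoIsoPosDisc_of_epsilon` re-keyed to the typed binder; CONDITIONAL; nothing closed.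
[cite: Kato2004Asterisque, Thm. 17.4 (1)(2) (p. 273)] [cite: AbbesUllmo1996, Thm. A] [cite: CoatesSujatha2005, Conj. A (shape)] -/
theorem ordKatoHalfAtTwoIsoPosDisc_of_halfClassPosDisc_of_conjA
    (hPos : ∀ (W : WeierstrassCurve ℚ) [W.IsElliptic] [W.IsGloballyMinimal], ¬ W.HasCM → W.analyticRank = 0 →
      GoodOrd W 2 → W.HasSurjectiveModNGaloisRep 2 → 0 < W.Δ →
      ∀ {N : ℕ} [NeZero N] (f : CuspForm (Gamma0 N) 2) (κ : ZpExtension ℚ 2) (γ : absoluteGaloisGroup ℚ),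
        κ.IsCyclotomic → κ.IsTopGenerator γ → IsCyclotomicVariable 2 γ → IsNewformOf W f →
        ∀ (D : W.SelmerDualData κ γ) (Y : W.FineSelmerDualData κ γ), HasColemanHalfClassPackageAtTwo W f κ γ D Y)
    (hQ : FineSelmerConjATwoOrdPosDisc) (hAU : abbesUllmo_not_dvd_maninConstant_of_not_dvd_level)
    (h17 : ∀ (V : WeierstrassCurve ℚ) [V.IsElliptic] [V.IsGloballyMinimal] [NeZero (V.conductorNorm ℤ)]
      (f : CuspForm (Gamma0 (V.conductorNorm ℤ)) 2), kato_divisibility_allPrimes V 2 (f := f)) :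
    OrdKatoHalfAtTwoIsoPosDisc :=
  fun W _ _ hcm hr hgo h2 hΔ =>
    ⟨W, ‹_›, ‹_›, isIsogenous_self W,
      mainConjectureLowerDivisibilityAtTwoOrd_of_halfClassPosDisc_of_conjA hPos hQ hAU W hcm hr hgo h2 hΔ (h17 W)⟩

/-! ## §3 The crux BY NAME: three Coleman readings in one currency + Q⁺ (or Iw⁺) + print -/

/-- **THE CRUX `OrdKatoHalfAtTwoIso` (stmt-BirchSwinnertonDyer-19573) BY NAME from its Coleman readings in ONE per-datum currency and
print**: F1μι⁻ `ZetaColemanMuIotaNegDiscAtTwo` (cell [`ρ̄₂` onto ∧ `Δ < 0`]: zeta classes — implies the half-class package there,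
p700838, and its span clause feeds the PROVED core Theorem A p669276), (Col½⁺) the half-class package at every curve of [`ρ̄₂` onto ∧
`0 < Δ`], Q⁺ (Coates–Sujatha (A) at `2` there — research), (Col½-opt) the half-class package at every lattice-optimal member of every
non-CM good-ordinary class with `ρ̄₂` NOT onto, and PRINT by name: the bundle (child 23889: PUB ∧ Abbes–Ullmo ∧ Greenberg 5.14@2),
Lim 2017 Thm 3.5 at `2`, Ferrero–Washington (the last two give (A₂) on the not-onto class, p695632/p699886). Assembly: lead g5's
split door `ordKatoHalfAtTwoIso_of_iota_halves` (p695020) with the `0 < Δ` input from §2 and B7′ from p700838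
`katoMuPartOff514_of_print_of_colemanHalfClassPackage`. CONDITIONAL on the displayed OPEN statements; nothing closed.
[cite: Kato2004Asterisque, Thm. 17.4 (1)(2) (p. 273), §17.13 (pp. 279–280)] [cite: GreenbergLNM1716, Prop. 5.14 (p. 130)]
[cite: AbbesUllmo1996, Thm. A] [cite: Lim2017FineSelmer, §3 Thm. 3.5 and Lemma 3.2] [cite: FerreroWashington1979, main theorem] -/
theorem ordKatoHalfAtTwoIso_of_negDisc_of_halfClass_of_conjA_of_print (hNeg : ZetaColemanMuIotaNegDiscAtTwo)
    (hPos : ∀ (W : WeierstrassCurve ℚ) [W.IsElliptic] [W.IsGloballyMinimal], ¬ W.HasCM → W.analyticRank = 0 →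
      GoodOrd W 2 → W.HasSurjectiveModNGaloisRep 2 → 0 < W.Δ →
      ∀ {N : ℕ} [NeZero N] (f : CuspForm (Gamma0 N) 2) (κ : ZpExtension ℚ 2) (γ : absoluteGaloisGroup ℚ),
        κ.IsCyclotomic → κ.IsTopGenerator γ → IsCyclotomicVariable 2 γ → IsNewformOf W f →
        ∀ (D : W.SelmerDualData κ γ) (Y : W.FineSelmerDualData κ γ), HasColemanHalfClassPackageAtTwo W f κ γ D Y)
    (hQ : FineSelmerConjATwoOrdPosDisc)
    (hCol : ∀ (W : WeierstrassCurve ℚ) [W.IsElliptic] [W.IsGloballyMinimal],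
      ¬ W.HasCM → GoodOrd W 2 → ¬ W.HasSurjectiveModNGaloisRep 2 →
      ∀ (W₀ : WeierstrassCurve ℚ) [W₀.IsElliptic] [W₀.IsGloballyMinimal] {N₀ : ℕ} [NeZero N₀]
        (D₀ : ModularParametrizationData W₀ N₀), WeierstrassCurve.IsIsogenous W W₀ →
        (∀ z ∈ D₀.L.lattice, ∃ w ∈ periodLattice D₀.f, z = D₀.c * w) →
      ∀ {N : ℕ} [NeZero N] (f : CuspForm (Gamma0 N) 2) (κ : ZpExtension ℚ 2) (γ : absoluteGaloisGroup ℚ),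
        κ.IsCyclotomic → κ.IsTopGenerator γ → IsCyclotomicVariable 2 γ → IsNewformOf W₀ f →
        ∀ (D : W₀.SelmerDualData κ γ) (Y : W₀.FineSelmerDualData κ γ), HasColemanHalfClassPackageAtTwo W₀ f κ γ D Y)
    (hbundle : OrdPublishedInputsAtTwo ∧ abbesUllmo_not_dvd_maninConstant_of_not_dvd_level ∧
      Greenberg1999.prop514_isTorsion_mu_eq_zero_two)
    (hLim2 : Lim2017.thm35_at_two_fineSelmerDual_moduleFinite_of_classicalMuVanishes_of_le_divisionField_four)
    (hFW : ferreroWashington1979_classicalMuVanishes) : OrdKatoHalfAtTwoIso := by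
  have hAU := hbundle.2.1
  obtain ⟨hMod, _, h17, _⟩ := hbundle.1
  exact ordKatoHalfAtTwoIso_of_iota_halves hNeg (ordKatoHalfAtTwoIsoPosDisc_of_halfClassPosDisc_of_conjA hPos hQ hAU h17)
    hbundle (katoMuPartOff514_of_print_of_colemanHalfClassPackage hAU hMod hLim2 hFW hCol)

/-- **The crux BY NAME in the finest currency**: F1μι⁻, (Col½⁺), (Col½-opt) — three memo-tier Coleman readings —, Iw⁺ (Iwasawa's
classical `μ₂ = 0` for the cyclotomic `ℤ₂`-extension of `ℚ(E[2], √−1)` on the cell [onto ∧ `0 < Δ`]; OPEN, non-abelian ground field),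
and PRINT by name: the bundle (PUB ∧ Abbes–Ullmo ∧ Greenberg 5.14@2), Lim 2017 Thm 3.5 at `2` (used twice: Q⁺ via g6's
`fineSelmerConjATwoOrdPosDisc_of_lim_of_classicalMu`, and (A₂) on the not-onto class), Ferrero–Washington. CONDITIONAL; nothing closed.
[cite: Kato2004Asterisque, Thm. 17.4 (1)(2) (p. 273)] [cite: Lim2017FineSelmer, §3 Thm. 3.5 and Lemma 3.2]
[cite: Iwasawa1973MuInvariants, §1 (shape)] [cite: FerreroWashington1979, main theorem] -/
theorem ordKatoHalfAtTwoIso_of_negDisc_of_halfClass_of_lim_of_classicalMu_of_print (hNeg : ZetaColemanMuIotaNegDiscAtTwo)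
    (hPos : ∀ (W : WeierstrassCurve ℚ) [W.IsElliptic] [W.IsGloballyMinimal], ¬ W.HasCM → W.analyticRank = 0 →
      GoodOrd W 2 → W.HasSurjectiveModNGaloisRep 2 → 0 < W.Δ →
      ∀ {N : ℕ} [NeZero N] (f : CuspForm (Gamma0 N) 2) (κ : ZpExtension ℚ 2) (γ : absoluteGaloisGroup ℚ),
        κ.IsCyclotomic → κ.IsTopGenerator γ → IsCyclotomicVariable 2 γ → IsNewformOf W f →
        ∀ (D : W.SelmerDualData κ γ) (Y : W.FineSelmerDualData κ γ), HasColemanHalfClassPackageAtTwo W f κ γ D Y)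
    (hCol : ∀ (W : WeierstrassCurve ℚ) [W.IsElliptic] [W.IsGloballyMinimal],
      ¬ W.HasCM → GoodOrd W 2 → ¬ W.HasSurjectiveModNGaloisRep 2 →
      ∀ (W₀ : WeierstrassCurve ℚ) [W₀.IsElliptic] [W₀.IsGloballyMinimal] {N₀ : ℕ} [NeZero N₀]
        (D₀ : ModularParametrizationData W₀ N₀), WeierstrassCurve.IsIsogenous W W₀ →
        (∀ z ∈ D₀.L.lattice, ∃ w ∈ periodLattice D₀.f, z = D₀.c * w) →
      ∀ {N : ℕ} [NeZero N] (f : CuspForm (Gamma0 N) 2) (κ : ZpExtension ℚ 2) (γ : absoluteGaloisGroup ℚ),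
        κ.IsCyclotomic → κ.IsTopGenerator γ → IsCyclotomicVariable 2 γ → IsNewformOf W₀ f →
        ∀ (D : W₀.SelmerDualData κ γ) (Y : W₀.FineSelmerDualData κ γ), HasColemanHalfClassPackageAtTwo W₀ f κ γ D Y)
    (hIw : ClassicalMuTwoDivisionFieldAdjoinIOrdPosDisc)
    (hbundle : OrdPublishedInputsAtTwo ∧ abbesUllmo_not_dvd_maninConstant_of_not_dvd_level ∧
      Greenberg1999.prop514_isTorsion_mu_eq_zero_two)
    (hLim2 : Lim2017.thm35_at_two_fineSelmerDual_moduleFinite_of_classicalMuVanishes_of_le_divisionField_four)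
    (hFW : ferreroWashington1979_classicalMuVanishes) : OrdKatoHalfAtTwoIso :=
  ordKatoHalfAtTwoIso_of_negDisc_of_halfClass_of_conjA_of_print hNeg hPos
    (fineSelmerConjATwoOrdPosDisc_of_lim_of_classicalMu hLim2 hIw) hCol hbundle hLim2 hFW

/-- **The same with the lead's P⁺ in place of (Col½⁺)** (monotonicity §1): the crux ⟸ F1μι⁻ + P⁺ + Iw⁺ + (Col½-opt) + print — i.e.
g6's `ordKatoHalfAtTwoIso_of_negDisc_of_colemanMu_of_lim_of_classicalMu` with its B7′ binder DISCHARGED modulo the half-class reading at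
the optimal member and two print facts. CONDITIONAL; nothing closed. [cite: Kato2004Asterisque, Thm. 17.4 (1)(2) (p. 273)]
[cite: Lim2017FineSelmer, §3 Thm. 3.5 and Lemma 3.2] [cite: FerreroWashington1979, main theorem] -/
theorem ordKatoHalfAtTwoIso_of_negDisc_of_colemanMu_of_halfClassOptimal_of_lim_of_classicalMu
    (hNeg : ZetaColemanMuIotaNegDiscAtTwo) (hP : ColemanMuSpanFreeIotaPosDiscAtTwo)
    (hCol : ∀ (W : WeierstrassCurve ℚ) [W.IsElliptic] [W.IsGloballyMinimal],
      ¬ W.HasCM → GoodOrd W 2 → ¬ W.HasSurjectiveModNGaloisRep 2 →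
      ∀ (W₀ : WeierstrassCurve ℚ) [W₀.IsElliptic] [W₀.IsGloballyMinimal] {N₀ : ℕ} [NeZero N₀]
        (D₀ : ModularParametrizationData W₀ N₀), WeierstrassCurve.IsIsogenous W W₀ →
        (∀ z ∈ D₀.L.lattice, ∃ w ∈ periodLattice D₀.f, z = D₀.c * w) →
      ∀ {N : ℕ} [NeZero N] (f : CuspForm (Gamma0 N) 2) (κ : ZpExtension ℚ 2) (γ : absoluteGaloisGroup ℚ),
        κ.IsCyclotomic → κ.IsTopGenerator γ → IsCyclotomicVariable 2 γ → IsNewformOf W₀ f →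
        ∀ (D : W₀.SelmerDualData κ γ) (Y : W₀.FineSelmerDualData κ γ), HasColemanHalfClassPackageAtTwo W₀ f κ γ D Y)
    (hIw : ClassicalMuTwoDivisionFieldAdjoinIOrdPosDisc)
    (hbundle : OrdPublishedInputsAtTwo ∧ abbesUllmo_not_dvd_maninConstant_of_not_dvd_level ∧
      Greenberg1999.prop514_isTorsion_mu_eq_zero_two)
    (hLim2 : Lim2017.thm35_at_two_fineSelmerDual_moduleFinite_of_classicalMuVanishes_of_le_divisionField_four)
    (hFW : ferreroWashington1979_classicalMuVanishes) : OrdKatoHalfAtTwoIso :=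
  ordKatoHalfAtTwoIso_of_negDisc_of_halfClass_of_lim_of_classicalMu_of_print hNeg
    (halfClassPosDisc_of_colemanMuSpanFreeIotaPosDiscAtTwo hP) hCol hIw hbundle hLim2 hFW

end Summit.BirchSwinnertonDyer.BirchSwinnertonDyer.Theorems.SteinbergFibreAtTwo

end
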